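import Summits.KontsevichZagierPeriods.Zeta5Search.Certificates.RayH1DualNumerics
import HarnessLib

/-!
# ζ(5) search — certificates: the dual series of the ray RayH1 (`e = 0`: b itself) — the WINDOW bound
(cell `pub-zeta5`, P1 g11; port of certifier 2's `RecordRayDualSeriesWindow/Rate`)

HONEST FRAMING: systematic search; no irrationality claim unless certified.

OUR work (Summit side). `Hh1E0 n μ` = the entropy combination of `log T̂(μ)` for `B = BH1E 0 n`;
`Hh1E0_window_le` (tangent bounds keeping the cancellation), `slopeh1E0_le` (the window slope is `≤ Λ⁺` for `n ≥ 100`),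
`Hh1E0_base_le` (floor stability at `μ₀ = u₀n − 1`), and **`Hh1E0_window_bound`**:
`H(n, μ) ≤ n·(ĥ(2/5) + Λ⁺/20) + 2Λ⁺ + 96(1 + log(35n))` on `u₀n − 1 ≤ μ ≤ u₁n + 1` (`n ≥ 100`; `[u₀,u₁] = [9 / 50, 1 / 5]`, `w = u₁ − u₀`).
-/

noncomputable section

open Finset Real

namespace Summit.KontsevichZagierPeriods.Zeta5Search.RayH1

open Summit.KontsevichZagierPeriods.Zeta5Search.RecordRay (ent ent_shift_le ent_shift_ge log_le_log_sub ent_scale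
  ent_pred_le ent_pred_ge ent_ge_of_near)

/-- `H(n, μ) = ent(34n+μ+1, μ) − Σ_j ent(m_j, k_j)` for `B = BH1E 0 n`. -/
def Hh1E0 (n μ : ℝ) : ℝ :=
  ent (34 * n + μ + 1) μ - (ent (20 * n + μ + 1) (14 * n + μ) + ent (21 * n + μ + 1) (13 * n + μ) + ent (22 * n + μ + 1) (12 * n + μ) + ent (23 * n + μ + 1) (11 * n + μ) + ent (24 * n + μ + 1) (10 * n + μ) + ent (25 * n + μ + 1) (9 * n + μ) + ent (26 * n + μ + 1) (8 * n + μ))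

/-- The explicit slope of the window inequality. -/
def slopeh1E0 (n μ₀ μ₁ : ℝ) : ℝ :=
  (Real.log (34 * n + μ₁ + 1) - Real.log μ₀) - ((Real.log (20 * n + μ₀ + 1) - Real.log (14 * n + μ₁)) + (Real.log (21 * n + μ₀ + 1) - Real.log (13 * n + μ₁)) + (Real.log (22 * n + μ₀ + 1) - Real.log (12 * n + μ₁)) + (Real.log (23 * n + μ₀ + 1) - Real.log (11 * n + μ₁)) + (Real.log (24 * n + μ₀ + 1) - Real.log (10 * n + μ₁)) + (Real.log (25 * n + μ₀ + 1) - Real.log (9 * n + μ₁)) + (Real.log (26 * n + μ₀ + 1) - Real.log (8 * n + μ₁)))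

set_option maxHeartbeats 800000 in
-- fourteen tangent inequalities assembled by one `linarith`
/-- **Window inequality**: for `1 ≤ n`, `0 < μ₀ ≤ μ ≤ μ₁`: `H(n, μ) ≤ H(n, μ₀) + (μ − μ₀)·slope(n, μ₀, μ₁)`. -/
theorem Hh1E0_window_le {n μ₀ μ μ₁ : ℝ} (hn : 1 ≤ n) (h0 : 0 < μ₀) (h01 : μ₀ ≤ μ) (h1 : μ ≤ μ₁) :
    Hh1E0 n μ ≤ Hh1E0 n μ₀ + (μ - μ₀) * slopeh1E0 n μ₀ μ₁ := by
  have hδ : 0 ≤ μ - μ₀ := by linarith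
  have hnum := ent_shift_le (m := 34 * n + μ₀ + 1) (k := μ₀) (δ := μ - μ₀) (by linarith) h0 hδ
  have hnum' : (μ - μ₀) * (Real.log (34 * n + μ₀ + 1 + (μ - μ₀)) - Real.log μ₀) ≤
      (μ - μ₀) * (Real.log (34 * n + μ₁ + 1) - Real.log μ₀) := by
    apply mul_le_mul_of_nonneg_left _ hδ
    have := Real.log_le_log (by linarith : 0 < 34 * n + μ₀ + 1 + (μ - μ₀)) (by linarith : 34 * n + μ₀ + 1 + (μ - μ₀) ≤ 34 * n + μ₁ + 1)
    linarith
  have en : 34 * n + μ₀ + 1 + (μ - μ₀) = 34 * n + μ + 1 := by ring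
  have ek : μ₀ + (μ - μ₀) = μ := by ring
  rw [en, ek] at hnum
  rw [en] at hnum'
  have hd0 : (μ - μ₀) * (Real.log (20 * n + μ₀ + 1) - Real.log (14 * n + μ₁)) ≤ ent (20 * n + μ + 1) (14 * n + μ) - ent (20 * n + μ₀ + 1) (14 * n + μ₀) := by
    have h := ent_shift_ge (m := (20 * n + μ₀ + 1)) (k := (14 * n + μ₀)) (δ := μ - μ₀) (by linarith) (by linarith) hδ
    have eM : (20 * n + μ₀ + 1) + (μ - μ₀) = (20 * n + μ + 1) := by ring
    have eK : (14 * n + μ₀) + (μ - μ₀) = (14 * n + μ) := by ring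
    rw [eM, eK] at h
    have hmono : Real.log (14 * n + μ) ≤ Real.log (14 * n + μ₁) := Real.log_le_log (by linarith) (by linarith)
    have hmul : (μ - μ₀) * (Real.log (20 * n + μ₀ + 1) - Real.log (14 * n + μ₁)) ≤ (μ - μ₀) * (Real.log (20 * n + μ₀ + 1) - Real.log (14 * n + μ)) := by
      apply mul_le_mul_of_nonneg_left _ hδ; linarith
    linarith
  have hd1 : (μ - μ₀) * (Real.log (21 * n + μ₀ + 1) - Real.log (13 * n + μ₁)) ≤ ent (21 * n + μ + 1) (13 * n + μ) - ent (21 * n + μ₀ + 1) (13 * n + μ₀) := by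
    have h := ent_shift_ge (m := (21 * n + μ₀ + 1)) (k := (13 * n + μ₀)) (δ := μ - μ₀) (by linarith) (by linarith) hδ
    have eM : (21 * n + μ₀ + 1) + (μ - μ₀) = (21 * n + μ + 1) := by ring
    have eK : (13 * n + μ₀) + (μ - μ₀) = (13 * n + μ) := by ring
    rw [eM, eK] at h
    have hmono : Real.log (13 * n + μ) ≤ Real.log (13 * n + μ₁) := Real.log_le_log (by linarith) (by linarith)
    have hmul : (μ - μ₀) * (Real.log (21 * n + μ₀ + 1) - Real.log (13 * n + μ₁)) ≤ (μ - μ₀) * (Real.log (21 * n + μ₀ + 1) - Real.log (13 * n + μ)) := by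
      apply mul_le_mul_of_nonneg_left _ hδ; linarith
    linarith
  have hd2 : (μ - μ₀) * (Real.log (22 * n + μ₀ + 1) - Real.log (12 * n + μ₁)) ≤ ent (22 * n + μ + 1) (12 * n + μ) - ent (22 * n + μ₀ + 1) (12 * n + μ₀) := by
    have h := ent_shift_ge (m := (22 * n + μ₀ + 1)) (k := (12 * n + μ₀)) (δ := μ - μ₀) (by linarith) (by linarith) hδ
    have eM : (22 * n + μ₀ + 1) + (μ - μ₀) = (22 * n + μ + 1) := by ring
    have eK : (12 * n + μ₀) + (μ - μ₀) = (12 * n + μ) := by ring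
    rw [eM, eK] at h
    have hmono : Real.log (12 * n + μ) ≤ Real.log (12 * n + μ₁) := Real.log_le_log (by linarith) (by linarith)
    have hmul : (μ - μ₀) * (Real.log (22 * n + μ₀ + 1) - Real.log (12 * n + μ₁)) ≤ (μ - μ₀) * (Real.log (22 * n + μ₀ + 1) - Real.log (12 * n + μ)) := by
      apply mul_le_mul_of_nonneg_left _ hδ; linarith
    linarith
  have hd3 : (μ - μ₀) * (Real.log (23 * n + μ₀ + 1) - Real.log (11 * n + μ₁)) ≤ ent (23 * n + μ + 1) (11 * n + μ) - ent (23 * n + μ₀ + 1) (11 * n + μ₀) := by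
    have h := ent_shift_ge (m := (23 * n + μ₀ + 1)) (k := (11 * n + μ₀)) (δ := μ - μ₀) (by linarith) (by linarith) hδ
    have eM : (23 * n + μ₀ + 1) + (μ - μ₀) = (23 * n + μ + 1) := by ring
    have eK : (11 * n + μ₀) + (μ - μ₀) = (11 * n + μ) := by ring
    rw [eM, eK] at h
    have hmono : Real.log (11 * n + μ) ≤ Real.log (11 * n + μ₁) := Real.log_le_log (by linarith) (by linarith)
    have hmul : (μ - μ₀) * (Real.log (23 * n + μ₀ + 1) - Real.log (11 * n + μ₁)) ≤ (μ - μ₀) * (Real.log (23 * n + μ₀ + 1) - Real.log (11 * n + μ)) := by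
      apply mul_le_mul_of_nonneg_left _ hδ; linarith
    linarith
  have hd4 : (μ - μ₀) * (Real.log (24 * n + μ₀ + 1) - Real.log (10 * n + μ₁)) ≤ ent (24 * n + μ + 1) (10 * n + μ) - ent (24 * n + μ₀ + 1) (10 * n + μ₀) := by
    have h := ent_shift_ge (m := (24 * n + μ₀ + 1)) (k := (10 * n + μ₀)) (δ := μ - μ₀) (by linarith) (by linarith) hδ
    have eM : (24 * n + μ₀ + 1) + (μ - μ₀) = (24 * n + μ + 1) := by ring
    have eK : (10 * n + μ₀) + (μ - μ₀) = (10 * n + μ) := by ring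
    rw [eM, eK] at h
    have hmono : Real.log (10 * n + μ) ≤ Real.log (10 * n + μ₁) := Real.log_le_log (by linarith) (by linarith)
    have hmul : (μ - μ₀) * (Real.log (24 * n + μ₀ + 1) - Real.log (10 * n + μ₁)) ≤ (μ - μ₀) * (Real.log (24 * n + μ₀ + 1) - Real.log (10 * n + μ)) := by
      apply mul_le_mul_of_nonneg_left _ hδ; linarith
    linarith
  have hd5 : (μ - μ₀) * (Real.log (25 * n + μ₀ + 1) - Real.log (9 * n + μ₁)) ≤ ent (25 * n + μ + 1) (9 * n + μ) - ent (25 * n + μ₀ + 1) (9 * n + μ₀) := by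
    have h := ent_shift_ge (m := (25 * n + μ₀ + 1)) (k := (9 * n + μ₀)) (δ := μ - μ₀) (by linarith) (by linarith) hδ
    have eM : (25 * n + μ₀ + 1) + (μ - μ₀) = (25 * n + μ + 1) := by ring
    have eK : (9 * n + μ₀) + (μ - μ₀) = (9 * n + μ) := by ring
    rw [eM, eK] at h
    have hmono : Real.log (9 * n + μ) ≤ Real.log (9 * n + μ₁) := Real.log_le_log (by linarith) (by linarith)
    have hmul : (μ - μ₀) * (Real.log (25 * n + μ₀ + 1) - Real.log (9 * n + μ₁)) ≤ (μ - μ₀) * (Real.log (25 * n + μ₀ + 1) - Real.log (9 * n + μ)) := by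
      apply mul_le_mul_of_nonneg_left _ hδ; linarith
    linarith
  have hd6 : (μ - μ₀) * (Real.log (26 * n + μ₀ + 1) - Real.log (8 * n + μ₁)) ≤ ent (26 * n + μ + 1) (8 * n + μ) - ent (26 * n + μ₀ + 1) (8 * n + μ₀) := by
    have h := ent_shift_ge (m := (26 * n + μ₀ + 1)) (k := (8 * n + μ₀)) (δ := μ - μ₀) (by linarith) (by linarith) hδ
    have eM : (26 * n + μ₀ + 1) + (μ - μ₀) = (26 * n + μ + 1) := by ring
    have eK : (8 * n + μ₀) + (μ - μ₀) = (8 * n + μ) := by ring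
    rw [eM, eK] at h
    have hmono : Real.log (8 * n + μ) ≤ Real.log (8 * n + μ₁) := Real.log_le_log (by linarith) (by linarith)
    have hmul : (μ - μ₀) * (Real.log (26 * n + μ₀ + 1) - Real.log (8 * n + μ₁)) ≤ (μ - μ₀) * (Real.log (26 * n + μ₀ + 1) - Real.log (8 * n + μ)) := by
      apply mul_le_mul_of_nonneg_left _ hδ; linarith
    linarith
  unfold Hh1E0 slopeh1E0
  rw [mul_sub]
  linarith [hd0, hd1, hd2, hd3, hd4, hd5, hd6, hnum, hnum']

/-- **The slope of the window is `≤ Λ⁺`** for `n ≥ 100` (`μ₀ = u₀n − 1`, `μ₁ = u₁n + 1`). -/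
theorem slopeh1E0_le {n : ℝ} (hn : 100 ≤ n) :
    slopeh1E0 n (9 / 50 * n - 1) (1 / 5 * n + 1) ≤ lambdaPlush1 := by
  unfold slopeh1E0 lambdaPlush1
  have h0 : 0 < 9 / 50 * n - 1 := by nlinarith
  have hnum : Real.log (34 * n + (1 / 5 * n + 1) + 1) - Real.log (9 / 50 * n - 1) ≤ Real.log 208 := by
    have h := Real.log_le_log (by linarith : 0 < 34 * n + (1 / 5 * n + 1) + 1)
      (show 34 * n + (1 / 5 * n + 1) + 1 ≤ 208 * (9 / 50 * n - 1) by linarith)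
    rw [Real.log_mul (by norm_num) h0.ne'] at h
    linarith
  have e0 := log_le_log_sub (a := 20 * n + (9 / 50 * n - 1) + 1) (b := 14 * n + (1 / 5 * n + 1)) (c := 2017 / 1422)
    (by linarith) (by norm_num) (by linarith)
  have e1 := log_le_log_sub (a := 21 * n + (9 / 50 * n - 1) + 1) (b := 13 * n + (1 / 5 * n + 1)) (c := 2117 / 1322)
    (by linarith) (by norm_num) (by linarith)
  have e2 := log_le_log_sub (a := 22 * n + (9 / 50 * n - 1) + 1) (b := 12 * n + (1 / 5 * n + 1)) (c := 2217 / 1222)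
    (by linarith) (by norm_num) (by linarith)
  have e3 := log_le_log_sub (a := 23 * n + (9 / 50 * n - 1) + 1) (b := 11 * n + (1 / 5 * n + 1)) (c := 2317 / 1122)
    (by linarith) (by norm_num) (by linarith)
  have e4 := log_le_log_sub (a := 24 * n + (9 / 50 * n - 1) + 1) (b := 10 * n + (1 / 5 * n + 1)) (c := 2417 / 1022)
    (by linarith) (by norm_num) (by linarith)
  have e5 := log_le_log_sub (a := 25 * n + (9 / 50 * n - 1) + 1) (b := 9 * n + (1 / 5 * n + 1)) (c := 2517 / 922)
    (by linarith) (by norm_num) (by linarith)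
  have e6 := log_le_log_sub (a := 26 * n + (9 / 50 * n - 1) + 1) (b := 8 * n + (1 / 5 * n + 1)) (c := 2617 / 822)
    (by linarith) (by norm_num) (by linarith)
  norm_num only at e0 e1 e2 e3 e4 e5 e6 ⊢
  linarith

/-- **Base value**: `H(n, u₀n − 1) ≤ n·ĥ(u₀) + 96·(1 + log(35n))` for `n ≥ 20`. -/
theorem Hh1E0_base_le {n : ℝ} (hn : 20 ≤ n) :
    Hh1E0 n (9 / 50 * n - 1) ≤ n * hhath1 + 96 * (1 + Real.log (35 * n)) := by
  have hn0 : 0 < n := by linarith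
  have eN : ent (34 * n + (9 / 50 * n - 1) + 1) (9 / 50 * n - 1) = ent (1709 / 50 * n) (9 / 50 * n - 1) := by congr 1; ring
  have e0 : ent (20 * n + (9 / 50 * n - 1) + 1) (14 * n + (9 / 50 * n - 1)) = ent (1009 / 50 * n) (709 / 50 * n - 1) := by congr 1 <;> ring
  have e1 : ent (21 * n + (9 / 50 * n - 1) + 1) (13 * n + (9 / 50 * n - 1)) = ent (1059 / 50 * n) (659 / 50 * n - 1) := by congr 1 <;> ring
  have e2 : ent (22 * n + (9 / 50 * n - 1) + 1) (12 * n + (9 / 50 * n - 1)) = ent (1109 / 50 * n) (609 / 50 * n - 1) := by congr 1 <;> ring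
  have e3 : ent (23 * n + (9 / 50 * n - 1) + 1) (11 * n + (9 / 50 * n - 1)) = ent (1159 / 50 * n) (559 / 50 * n - 1) := by congr 1 <;> ring
  have e4 : ent (24 * n + (9 / 50 * n - 1) + 1) (10 * n + (9 / 50 * n - 1)) = ent (1209 / 50 * n) (509 / 50 * n - 1) := by congr 1 <;> ring
  have e5 : ent (25 * n + (9 / 50 * n - 1) + 1) (9 * n + (9 / 50 * n - 1)) = ent (1259 / 50 * n) (459 / 50 * n - 1) := by congr 1 <;> ring
  have e6 : ent (26 * n + (9 / 50 * n - 1) + 1) (8 * n + (9 / 50 * n - 1)) = ent (1309 / 50 * n) (409 / 50 * n - 1) := by congr 1 <;> ring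
  unfold Hh1E0
  rw [eN, e0, e1, e2, e3, e4, e5, e6]
  have aN := ent_pred_le (m := 1709 / 50 * n) (k := 9 / 50 * n) (M := 35 * n) (by linarith only [hn]) (by linarith only [hn]) (by linarith only [hn])
  have b0 := ent_pred_ge (m := 1009 / 50 * n) (k := 709 / 50 * n) (M := 35 * n) (by linarith only [hn]) (by linarith only [hn]) (by linarith only [hn])
  have b1 := ent_pred_ge (m := 1059 / 50 * n) (k := 659 / 50 * n) (M := 35 * n) (by linarith only [hn]) (by linarith only [hn]) (by linarith only [hn])
  have b2 := ent_pred_ge (m := 1109 / 50 * n) (k := 609 / 50 * n) (M := 35 * n) (by linarith only [hn]) (by linarith only [hn]) (by linarith only [hn])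
  have b3 := ent_pred_ge (m := 1159 / 50 * n) (k := 559 / 50 * n) (M := 35 * n) (by linarith only [hn]) (by linarith only [hn]) (by linarith only [hn])
  have b4 := ent_pred_ge (m := 1209 / 50 * n) (k := 509 / 50 * n) (M := 35 * n) (by linarith only [hn]) (by linarith only [hn]) (by linarith only [hn])
  have b5 := ent_pred_ge (m := 1259 / 50 * n) (k := 459 / 50 * n) (M := 35 * n) (by linarith only [hn]) (by linarith only [hn]) (by linarith only [hn])
  have b6 := ent_pred_ge (m := 1309 / 50 * n) (k := 409 / 50 * n) (M := 35 * n) (by linarith only [hn]) (by linarith only [hn]) (by linarith only [hn])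
  have sN := ent_scale hn0 (1709 / 50) (9 / 50)
  have s0 := ent_scale hn0 (1009 / 50) (709 / 50)
  have s1 := ent_scale hn0 (1059 / 50) (659 / 50)
  have s2 := ent_scale hn0 (1109 / 50) (609 / 50)
  have s3 := ent_scale hn0 (1159 / 50) (559 / 50)
  have s4 := ent_scale hn0 (1209 / 50) (509 / 50)
  have s5 := ent_scale hn0 (1259 / 50) (459 / 50)
  have s6 := ent_scale hn0 (1309 / 50) (409 / 50)
  have hh : n * hhath1 = n * ent (1709 / 50) (9 / 50) - (n * ent (1009 / 50) (709 / 50) + n * ent (1059 / 50) (659 / 50) + n * ent (1109 / 50) (609 / 50) + n * ent (1159 / 50) (559 / 50) + n * ent (1209 / 50) (509 / 50) + n * ent (1259 / 50) (459 / 50) + n * ent (1309 / 50) (409 / 50)) := by unfold hhath1; ring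
  rw [hh, ← sN, ← s0, ← s1, ← s2, ← s3, ← s4, ← s5, ← s6]
  linarith only [aN, b0, b1, b2, b3, b4, b5, b6]

/-- **Window bound**: for `n ≥ 100` and `2n/5 − 1 ≤ μ ≤ 9n/20 + 1`,
`H(n, μ) ≤ n·(ĥ(u₀) + Λ⁺·w) + 2Λ⁺ + 96·(1 + log(35n))`. -/
theorem Hh1E0_window_bound {n μ : ℝ} (hn : 100 ≤ n) (hlo : 9 / 50 * n - 1 ≤ μ) (hhi : μ ≤ 1 / 5 * n + 1) :
    Hh1E0 n μ ≤ n * (hhath1 + lambdaPlush1 * (1 / 50)) + 2 * lambdaPlush1 + 96 * (1 + Real.log (35 * n)) := by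
  have hw := Hh1E0_window_le (n := n) (μ₀ := 9 / 50 * n - 1) (μ := μ) (μ₁ := 1 / 5 * n + 1) (by linarith) (by linarith) hlo hhi
  have hs := slopeh1E0_le hn
  have hb := Hh1E0_base_le (n := n) (by linarith)
  obtain ⟨lp0, -⟩ := lambdaPlush1_bounds
  have hδ : 0 ≤ μ - (9 / 50 * n - 1) := by linarith
  have h1 : (μ - (9 / 50 * n - 1)) * slopeh1E0 n (9 / 50 * n - 1) (1 / 5 * n + 1) ≤ (μ - (9 / 50 * n - 1)) * lambdaPlush1 :=
    mul_le_mul_of_nonneg_left hs hδ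
  have h2 : (μ - (9 / 50 * n - 1)) * lambdaPlush1 ≤ ((1 / 50) * n + 2) * lambdaPlush1 :=
    mul_le_mul_of_nonneg_right (by linarith) (by linarith)
  nlinarith [hw, h1, h2, hb]

end Summit.KontsevichZagierPeriods.Zeta5Search.RayH1
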